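import Summits.BirchSwinnertonDyer.Rank1Residual.X5.TwoAdicAdditiveL2
import Summits.BirchSwinnertonDyer.BirchSwinnertonDyer.Theorems.GoldfeldGoodTwistsLocalTwo
import Summits.BirchSwinnertonDyer.BirchSwinnertonDyer.Theorems.TwoAdicConverseGoodTwistsMult
import Summits.BirchSwinnertonDyer.Rank1Residual.AdditivePotMult.NonvanishingTwist
import Literature.NumberTheory.EllipticCurves.NonvanishingTwistsHoffsteinLuo
import Literature.NumberTheory.QuadraticFields.FundamentalDiscriminant
import Literature.NumberTheory.EllipticCurves.QuadraticTwistJInvariantProofs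
import Literature.NumberTheory.EllipticCurves.GlobalMinimalModelProofs
import Literature.NumberTheory.EllipticCurves.NoEverywhereGoodReductionRat
import Literature.NumberTheory.EllipticCurves.LFunctionSmulProofs
import HarnessLib

/-!
# Route `ByReductionTypeAtTwo` (rung K4), crux `AdditiveRankZeroAtTwo` (item
# stmt-BirchSwinnertonDyer-19098): the TWIST SUPPLY AT `2` of the lens «around» is PRINT — for every
# quadratically semistabilisable `E/ℚ` a quadratic field whose twist is SEMISTABLE at `2` with
# `L(E^{(d_K)}, 1) ≠ 0`, from Hoffstein–Luo 1997 (seat `bsd-2adic-addL2`, GEN 4)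

HONEST FRAMING (cell `bsd-2adic`, run/shared/lean/pub/bsd-2adic/, HUMAN RULINGS D-0036/D-0074):
theorems only; ONE displayed Literature named fact (Hoffstein–Luo, Math. Res. Lett. 4 (1997),
Theorem of §1: `HoffsteinLuo1997_exists_twist_L_one_ne_zero` — a squarefree `n ≡ 1 (mod 8)`, prime to
any prescribed finite set of odd primes, as large as wanted, with `L(E^{(n)}, 1) ≠ 0`, for EVERY
`E/ℚ`); nothing else asserted; no class closed. It discharges the binder `hTw` (twist supply at `2`,
`AddTwoL2.ExistsSemistabilisingNonvanishingTwist W`) of the class-level bridge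
`Theorems.additiveRankZeroAtTwo_of_siblings_of_overKC_of_defect`
(`Theorems/ByReductionTypeAtTwoAdditiveInputs.lean`) on the WHOLE quadratic sub-class
`AddTwoL2.QuadSemistabilisable W` — so that, inside route K4, the quadratic part (563 of the 1 945
book230 classes) of crux `AdditiveRankZeroAtTwo` costs exactly: PRINT + the three sibling rank-0
cruxes + the over-`K` input `AdditivePotMult.MissingPPartOverCAt (W.baseChange K) 2`.
PARTITION (D-0054): X5@2 ADDITIVE, quadratic sub-class (B1·O1; 563 classes) × p = 2 —
types-the-object-of (input (b₂) of MEMO-1's doors L2-Q / L2-Q′); closes none.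

## The construction (MEMO-1 §3 «(b₂) in print modulo bookkeeping», now in the kernel)

`E` quadratically semistabilisable: some twist `E^{(d)}`, `d ∈ ℚ^×`, is good or multiplicative at
`2`; reduce `d` to a squarefree integer `t` (twists by squares are isomorphic). Apply Hoffstein–Luo to
`E' := E^{(t)}` with the odd prime factors of `t` prescribed: a squarefree `n ≡ 1 (mod 8)`, `|n| > 1`,
prime to `t`, with `L(E'^{(n)}, 1) ≠ 0`. Then `D := t n` (if `≡ 1 (mod 4)`) or `4 t n` is a
fundamental discriminant `≠ 1`, `K := ℚ(√D)` exists (`Quadratic.exists_numberField_discr_eq`),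
`E^{(d_K)} ≅ E'^{(n)}` (twist composition and square factors), so `L(E^{(d_K)},1) ≠ 0`; and `E'^{(n)}`
is good (resp. multiplicative) at `2` because `E'` is and `n ≡ 1 (mod 4)` is unramified at `2` (the
Goldfeld cell's `hasGoodReductionAtPrime_and_frobeniusTrace_of_smul_eq_quadraticTwist_two` through
globally minimal models; conv-1's `hasMultiplicativeReductionAtPrime_of_smul_eq_quadraticTwist_two`).
The field is ramified at `2` exactly when `E` is additive at `2` (not needed, not proved).

## Contents

* §1 `exists_squarefree_int_twist_of_quadSemistabilisable` — WLOG the semistabilising parameter is a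
  squarefree integer.
* §2 `good_or_mult_two_quadraticTwist_of_emod_four_eq_one` — unramified twists preserve «good or
  multiplicative at `2`» on any model.
* §3 `existsSemistabilisingNonvanishingTwist_of_hoffsteinLuo` — THE TWIST SUPPLY AT `2`; and its
  ∀-closed restatement `additiveTwistSupplyAtTwo_of_hoffsteinLuo` in the binder shape of
  `…AdditiveInputs.lean`.

References: [HoffsteinLuo1997] Theorem §1 (pp. 435–436); [SilvermanAEC2009] VII.5.1, VIII.8.3,
X.5.4; [DokchitserDokchitserAnnals2010] §2.1 (fundamental discriminants ↔ quadratic fields).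
-/

set_option autoImplicit false
-- the Theorems namespace of this sub repeats the summit name by design (D-0017 nested layout)
set_option linter.dupNamespace false

noncomputable section

open scoped Classical

open WeierstrassCurve Literature.NumberTheory.EllipticCurves
  Literature.NumberTheory.EllipticCurves.Rank1Residual
  Literature.NumberTheory.QuadraticFields
  Summit.BirchSwinnertonDyer.Rank1Residual.AdditivePotMult
  Summit.BirchSwinnertonDyer.Rank1Residual.X5.AddTwoL2

namespace Summit.BirchSwinnertonDyer.BirchSwinnertonDyer.Theorems

/-! ## §1. WLOG the semistabilising twist parameter is a squarefree integer -/

section Squarefree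

/-- «Good or multiplicative at `2`» is an isomorphism invariant (reduction types read the local
minimal model; tree `hasGoodReductionAtPrime_iff_of_variableChange`,
`hasMultiplicativeReductionAtPrime_smul_iff`). [cite: SilvermanAEC2009, VII.5 Prop. 5.1] -/
theorem good_or_mult_two_smul_iff (X : WeierstrassCurve ℚ) [X.IsElliptic] (C : VariableChange ℚ) :
    (Good (C • X) 2 ∨ Mult (C • X) 2) ↔ (Good X 2 ∨ Mult X 2) := by
  haveI : Fact (Nat.Prime 2) := ⟨Nat.prime_two⟩
  show ((C • X).HasGoodReductionAtPrime 2 ∨ (C • X).HasMultiplicativeReductionAtPrime 2) ↔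
    (X.HasGoodReductionAtPrime 2 ∨ X.HasMultiplicativeReductionAtPrime 2)
  rw [X.hasGoodReductionAtPrime_iff_of_variableChange C 2, hasMultiplicativeReductionAtPrime_smul_iff X C 2]

/-- **WLOG squarefree integer parameter.** If some twist `W^{(d)}`, `d ∈ ℚ^×`, is good or
multiplicative at `2`, then so is `W^{(t)}` for a squarefree INTEGER `t ≠ 0`: write
`d · den(d)² = num(d)·den(d) = ± b²·a` with `a` squarefree and put `t = ± a`; twists by parameters
differing by a nonzero square are `ℚ`-isomorphic (`exists_variableChange_quadraticTwist_mul_sq`).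
[cite: SilvermanAEC2009, X.5 Cor. 5.4] -/
theorem exists_squarefree_int_twist_of_quadSemistabilisable (W : WeierstrassCurve ℚ) [W.IsElliptic]
    (hq : QuadSemistabilisable W) :
    ∃ t : ℤ, t ≠ 0 ∧ Squarefree t ∧
      (Good (W.quadraticTwist (t : ℚ)) 2 ∨ Mult (W.quadraticTwist (t : ℚ)) 2) := by
  haveI : Fact (Nat.Prime 2) := ⟨Nat.prime_two⟩
  obtain ⟨d, hd0, hsemi⟩ := hq
  -- clear denominators: `d · den² = num · den =: m`
  set m : ℤ := d.num * d.den with hm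
  have hden0 : (d.den : ℚ) ≠ 0 := by exact_mod_cast d.den_ne_zero
  have hnum0 : d.num ≠ 0 := Rat.num_ne_zero.mpr hd0
  have hm0 : m ≠ 0 := mul_ne_zero hnum0 (by exact_mod_cast d.den_ne_zero)
  have hdm : d * (d.den : ℚ) ^ 2 = (m : ℚ) := by
    rw [hm, Int.cast_mul, Int.cast_natCast, sq, ← mul_assoc, Rat.mul_den_eq_num]
  -- squarefree kernel of `|m|`
  obtain ⟨a, b, ha, hb, hba, hasq⟩ := Nat.sq_mul_squarefree_of_pos (Int.natAbs_pos.mpr hm0)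
  set t : ℤ := m.sign * a with ht
  have hsign : m.sign = 1 ∨ m.sign = -1 := by
    rcases lt_trichotomy m 0 with h | h | h
    · exact Or.inr (Int.sign_eq_neg_one_of_neg h)
    · exact absurd h hm0
    · exact Or.inl (Int.sign_eq_one_of_pos h)
  have ht0 : t ≠ 0 := by
    rw [ht]; rcases hsign with h | h <;> rw [h] <;> omega
  have htsq : Squarefree t := by
    rw [← Int.squarefree_natAbs, ht, Int.natAbs_mul]
    rcases hsign with h | h <;> rw [h] <;> simpa using hasq
  have hmt : (m : ℚ) = (t : ℚ) * (b : ℚ) ^ 2 := by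
    have h1 : m = m.sign * (m.natAbs : ℤ) := (Int.sign_mul_natAbs m).symm
    have h2 : (m.natAbs : ℤ) = (b : ℤ) ^ 2 * (a : ℤ) := by exact_mod_cast hba.symm
    rw [h1, h2, ht]; push_cast; ring
  refine ⟨t, ht0, htsq, ?_⟩
  -- `W^{(d)} ≅ W^{(m)} ≅ W^{(t)}`
  obtain ⟨C₁, hC₁⟩ := W.exists_variableChange_quadraticTwist_mul_sq d (d.den : ℚ) hden0
  obtain ⟨C₂, hC₂⟩ := W.exists_variableChange_quadraticTwist_mul_sq (t : ℚ) (b : ℚ)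
    (by exact_mod_cast hb.ne')
  rw [hdm] at hC₁
  rw [← hmt] at hC₂
  have ht0' : (t : ℚ) ≠ 0 := by exact_mod_cast ht0
  have hm0' : (m : ℚ) ≠ 0 := by exact_mod_cast hm0
  haveI := W.isElliptic_quadraticTwist hd0
  haveI := W.isElliptic_quadraticTwist ht0'
  haveI := W.isElliptic_quadraticTwist hm0'
  have h1 : Good (W.quadraticTwist (m : ℚ)) 2 ∨ Mult (W.quadraticTwist (m : ℚ)) 2 := by
    rw [← hC₁]; exact (good_or_mult_two_smul_iff _ C₁).mpr hsemi
  rw [← hC₂] at h1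
  exact (good_or_mult_two_smul_iff _ C₂).mp h1

end Squarefree

/-! ## §2. Unramified twists (`n ≡ 1 (mod 4)`) preserve «good or multiplicative at `2`» -/

section Unramified

/-- **Good or multiplicative at `2` survives a twist by `n ≡ 1 (mod 4)`, on any model.** For `X/ℚ`
elliptic and `n ≡ 1 (mod 4)`: `X` good or multiplicative at `2` ⟹ `X^{(n)}` good or multiplicative
at `2`. Multiplicative: conv-1's `hasMultiplicativeReductionAtPrime_of_smul_eq_quadraticTwist_two`
(any models). Good: through globally minimal models `W₁ ≅ X`, `W₂ ≅ W₁^{(n)}` (Néron) and the Goldfeld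
cell's `hasGoodReductionAtPrime_and_frobeniusTrace_of_smul_eq_quadraticTwist_two`, transported back
by `quadraticTwist_smul` and isomorphism invariance. [cite: SilvermanAEC2009, VII.5 Prop. 5.1, X.5 Cor. 5.4.1] -/
theorem good_or_mult_two_quadraticTwist_of_emod_four_eq_one (X : WeierstrassCurve ℚ) [X.IsElliptic]
    {n : ℤ} (hn4 : n % 4 = 1) (h : Good X 2 ∨ Mult X 2) :
    Good (X.quadraticTwist (n : ℚ)) 2 ∨ Mult (X.quadraticTwist (n : ℚ)) 2 := by
  haveI : Fact (Nat.Prime 2) := ⟨Nat.prime_two⟩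
  have hn0 : ((n : ℤ) : ℚ) ≠ 0 := by exact_mod_cast (show n ≠ 0 by omega)
  haveI := X.isElliptic_quadraticTwist hn0
  rcases h with hg | hm
  · -- good: go through globally minimal models
    left
    obtain ⟨C₁, hC₁⟩ := hasGlobalMinimalModel_rat_holds X
    haveI : (C₁ • X).IsGloballyMinimal := hC₁
    have hg₁ : (C₁ • X).HasGoodReductionAtPrime 2 :=
      (X.hasGoodReductionAtPrime_iff_of_variableChange C₁ 2).mpr hg
    haveI : ((C₁ • X).quadraticTwist (n : ℚ)).IsElliptic := (C₁ • X).isElliptic_quadraticTwist hn0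
    obtain ⟨C₂, hC₂⟩ := hasGlobalMinimalModel_rat_holds ((C₁ • X).quadraticTwist (n : ℚ))
    haveI : (C₂ • (C₁ • X).quadraticTwist (n : ℚ)).IsGloballyMinimal := hC₂
    have hC₂' : C₂⁻¹ • (C₂ • (C₁ • X).quadraticTwist (n : ℚ)) = (C₁ • X).quadraticTwist (n : ℚ) :=
      inv_smul_smul C₂ _
    have hg₂ : (C₂ • (C₁ • X).quadraticTwist (n : ℚ)).HasGoodReductionAtPrime 2 :=
      (GoldfeldGoodTwists.hasGoodReductionAtPrime_and_frobeniusTrace_of_smul_eq_quadraticTwist_two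
        (C₁ • X) (C₂ • (C₁ • X).quadraticTwist (n : ℚ)) hn4 hC₂' 2 rfl hg₁).1
    have hg₃ : ((C₁ • X).quadraticTwist (n : ℚ)).HasGoodReductionAtPrime 2 :=
      (((C₁ • X).quadraticTwist (n : ℚ)).hasGoodReductionAtPrime_iff_of_variableChange C₂ 2).mp hg₂
    rw [quadraticTwist_smul] at hg₃
    exact ((X.quadraticTwist (n : ℚ)).hasGoodReductionAtPrime_iff_of_variableChange _ 2).mp hg₃
  · right
    exact TwoAdicGoodTwists.hasMultiplicativeReductionAtPrime_of_smul_eq_quadraticTwist_two X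
      (X.quadraticTwist (n : ℚ)) hn4 (C := (1 : VariableChange ℚ)) (one_smul _ _) 2 rfl hm

end Unramified

/-! ## §3. The twist supply at `2` from Hoffstein–Luo -/

section Supply

/-- Auxiliary: a squarefree integer is not divisible by `4`. [folklore] -/
theorem emod_four_ne_zero_of_squarefree {D : ℤ} (hD : Squarefree D) : D % 4 ≠ 0 := by
  intro h
  have h4 : (2 : ℤ) * 2 ∣ D := ⟨D / 4, by omega⟩
  have hu := hD 2 h4
  rw [Int.isUnit_iff] at hu
  omega

/-- **THE TWIST SUPPLY AT `2` (PROVED modulo Hoffstein–Luo 1997).** For every elliptic `W/ℚ` that is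
quadratically semistabilisable at `2` (`AddTwoL2.QuadSemistabilisable W`: some quadratic twist is good
or multiplicative at `2`) there is a quadratic field `K` such that the twist `W^{(d_K)}` is good or
multiplicative at `2` AND `L(W^{(d_K)}, 1) ≠ 0` — input (b₂)
`AddTwoL2.ExistsSemistabilisingNonvanishingTwist W` of MEMO-1's doors L2-Q / L2-Q′ and the binder
`hTw` of `Theorems.additiveRankZeroAtTwo_of_siblings_of_overKC_of_defect`. Construction in the module
docstring: squarefree parameter `t` (§1), Hoffstein–Luo's `n ≡ 1 (mod 8)` prime to `t` for
`E' = W^{(t)}`, `D ∈ {t n, 4 t n}` a fundamental discriminant, `K = ℚ(√D)`, `W^{(d_K)} ≅ E'^{(n)}`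
semistable at `2` (§2) with `L ≠ 0`. [cite: HoffsteinLuo1997, Theorem (§1, pp. 435–436)] -/
theorem existsSemistabilisingNonvanishingTwist_of_hoffsteinLuo
    (hHL : HoffsteinLuo1997_exists_twist_L_one_ne_zero) (W : WeierstrassCurve ℚ) [W.IsElliptic]
    (hq : QuadSemistabilisable W) : ExistsSemistabilisingNonvanishingTwist W := by
  haveI : Fact (Nat.Prime 2) := ⟨Nat.prime_two⟩
  obtain ⟨t, ht0, htsq, hsemi⟩ := exists_squarefree_int_twist_of_quadSemistabilisable W hq
  have ht0' : ((t : ℤ) : ℚ) ≠ 0 := by exact_mod_cast ht0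
  haveI := W.isElliptic_quadraticTwist ht0'
  -- Hoffstein–Luo on `E' = W^{(t)}`, odd prime factors of `t` prescribed
  obtain ⟨n, hB, hnsq, hn8, -, hjac, hL⟩ :=
    hHL (W.quadraticTwist (t : ℚ)) t.natAbs.primeFactors 1
  have hn4 : n % 4 = 1 := by omega
  have hn0 : n ≠ 0 := by omega
  have hn0' : ((n : ℤ) : ℚ) ≠ 0 := by exact_mod_cast hn0
  haveI := (W.quadraticTwist (t : ℚ)).isElliptic_quadraticTwist hn0'
  -- `t` and `n` are coprime, so `t n` is squarefree
  have hcop : Nat.Coprime t.natAbs n.natAbs := by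
    refine Nat.coprime_of_dvd fun k hk hkt hkn => ?_
    have hkn' : (k : ℤ) ∣ n := Int.ofNat_dvd_left.mpr hkn
    by_cases hk2 : k = 2
    · subst hk2
      omega
    · have hmem : k ∈ t.natAbs.primeFactors :=
        Nat.mem_primeFactors.mpr ⟨hk, hkt, Int.natAbs_ne_zero.mpr ht0⟩
      exact not_dvd_of_jacobiSym_eq_one hk (hjac k hmem hk hk2) hkn'
  have htnsq : Squarefree (t * n) := by
    rw [← Int.squarefree_natAbs, Int.natAbs_mul]
    exact Nat.squarefree_mul_iff.mpr
      ⟨hcop, Int.squarefree_natAbs.mpr htsq, Int.squarefree_natAbs.mpr hnsq⟩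
  have htn1 : t * n ≠ 1 := by
    intro h
    have h1 : (t * n).natAbs = 1 := by rw [h]; rfl
    rw [Int.natAbs_mul] at h1
    have : n.natAbs = 1 := Nat.eq_one_of_mul_eq_one_left h1
    omega
  have htn4 : (t * n) % 4 ≠ 0 := emod_four_ne_zero_of_squarefree htnsq
  -- the fundamental discriminant `D = t n e²`, `e ∈ {1, 2}`
  obtain ⟨D, e, he0, hDe, hD⟩ : ∃ (D : ℤ) (e : ℤ), e ≠ 0 ∧ D = t * n * e ^ 2 ∧
      ((D % 4 = 1 ∧ Squarefree D ∧ D ≠ 1) ∨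
        (4 ∣ D ∧ (D / 4 % 4 = 2 ∨ D / 4 % 4 = 3) ∧ Squarefree (D / 4))) := by
    by_cases h1 : (t * n) % 4 = 1
    · exact ⟨t * n, 1, one_ne_zero, by ring, Or.inl ⟨h1, htnsq, htn1⟩⟩
    · refine ⟨4 * (t * n), 2, two_ne_zero, by ring, Or.inr ⟨⟨t * n, rfl⟩, ?_, ?_⟩⟩
      · rw [Int.mul_ediv_cancel_left _ (by norm_num : (4 : ℤ) ≠ 0)]; omega
      · rw [Int.mul_ediv_cancel_left _ (by norm_num : (4 : ℤ) ≠ 0)]; exact htnsq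
  obtain ⟨K, _, _, h2, hdisc⟩ := Quadratic.exists_numberField_discr_eq hD
  -- `W^{(d_K)} = C • E'^{(n)}`
  obtain ⟨C, hC⟩ := W.exists_variableChange_quadraticTwist_mul_sq ((t : ℚ) * n) (e : ℚ)
    (by exact_mod_cast he0)
  have hDK : (NumberField.discr K : ℚ) = (t : ℚ) * n * (e : ℚ) ^ 2 := by
    rw [hdisc, hDe]; push_cast; ring
  have htw : W.quadraticTwist (NumberField.discr K : ℚ) =
      C • (W.quadraticTwist (t : ℚ)).quadraticTwist (n : ℚ) := by
    rw [hDK, ← hC, quadraticTwist_quadraticTwist]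
  refine ⟨K, inferInstance, inferInstance, h2, ?_, ?_⟩
  · -- semistable at `2`
    show Good (W.quadraticTwist (NumberField.discr K : ℚ)) 2 ∨
      Mult (W.quadraticTwist (NumberField.discr K : ℚ)) 2
    rw [htw, good_or_mult_two_smul_iff]
    exact good_or_mult_two_quadraticTwist_of_emod_four_eq_one _ hn4 hsemi
  · -- `L(W^{(d_K)}, 1) = L(E'^{(n)}, 1) ≠ 0`
    rw [htw, entireLFunction_smul]
    exact hL

/-- **The ∀-closed restatement in the binder shape of `…AdditiveInputs.lean`** (the hypothesis `hTw`
of `Theorems.additiveRankZeroAtTwo_of_siblings_of_overKC_of_defect` /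
`Theorems.additiveQuadraticAtTwo_of_siblings_of_overKC` / `Theorems.forall_overKC_iff_additiveQuadraticAtTwo`),
discharged on the whole quadratic sub-class from Hoffstein–Luo alone (the non-CM / rank / additivity
hypotheses are not used). [cite: HoffsteinLuo1997, Theorem (§1, pp. 435–436)] -/
theorem additiveTwistSupplyAtTwo_of_hoffsteinLuo (hHL : HoffsteinLuo1997_exists_twist_L_one_ne_zero) :
    ∀ (W : WeierstrassCurve ℚ) [W.IsElliptic] [W.IsGloballyMinimal],
      ¬ W.HasCM → W.analyticRank = 0 → Addv W 2 → QuadSemistabilisable W →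
      ExistsSemistabilisingNonvanishingTwist W :=
  fun W _ _ _ _ _ hq => existsSemistabilisingNonvanishingTwist_of_hoffsteinLuo hHL W hq

end Supply

end Summit.BirchSwinnertonDyer.BirchSwinnertonDyer.Theorems

end
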